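import Mathlib
import Summits.Ventures.PercRepro.TriangleCapVertexBound

/-!
# PercRepro — THE VERTEX BOUND WITH THE LEAF TERM EXPLICIT: a triangle-free graph with `s` edges and a vertex `w`
of degree `x` has `Σ_v d(v)² + 2x (s − x) ≤ s (s + 1) + 2 Σ_{u ∼ w} (d(u) − 1)` (p3, gen 49; part 203a)

The vertex bound of part 201g reads `Σ d² ≤ x² + (s − x)² + 3 (s − x) + x`: the `3 (s − x)` contains the star bound
`(s − x)(s − x + 1)` of the `s − x` edges off `w` PLUS the leaf interaction `2 (s − x)`, attained only when every edge
off `w` contains a neighbour of `w`. Here the leaf interaction is kept as what it is, `2 Σ_{u ∼ w} (d(u) − 1)` (the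
edges off `w` at the neighbours of `w`, each counted once — a triangle-free graph has no edge between two neighbours of
`w`): deleting the edges at `w` (`deleteIncidenceSet`) leaves a triangle-free graph `H′` with `s − x` edges whose
degrees are `d(v) − [v ∼ w]`, so `Σ_H d² = x² + x + Σ_{H′} d′² + 2 Σ_{u ∼ w} d′(u)` and `Σ_{H′} d′² ≤ (s − x)(s − x + 1)`
(the vertex bound of `H′` at the isolated `w`). On the bipartite class this is `closed_form_stability_bipSub_leaf`.
In the mixed deletion reads of the rows `r = a + j` with `a ≤ j + 4` (part 203d) the leaf term is cancelled against
the degrees of the in-side neighbours of the deleted vertex when the off-side neighbour `w₀` misses exactly the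
in-side neighbours — the configuration where the plain vertex bound is `2 (s − x)` too generous. Axioms: standard.
-/

namespace PercRepro

namespace TriangleCap

namespace C047

open Finset

variable {V : Type*} [Fintype V] [DecidableEq V]

/-- The neighbourhood of `v ≠ w` in `H.deleteIncidenceSet w` is the neighbourhood in `H` with `w` erased. -/
theorem nbhd_deleteIncidenceSet (H : SimpleGraph V) [DecidableRel H.Adj] (w v : V) (hv : v ≠ w) :
    univ.filter (fun u => (H.deleteIncidenceSet w).Adj v u) = (univ.filter (fun u => H.Adj v u)).erase w := by
  ext u
  rw [mem_filter, mem_erase, mem_filter, SimpleGraph.deleteIncidenceSet_adj]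
  constructor
  · rintro ⟨-, h, -, huw⟩
    exact ⟨huw, mem_univ _, h⟩
  · rintro ⟨huw, -, h⟩
    exact ⟨mem_univ _, h, hv, huw⟩

/-- The degree of `v ≠ w` in `H.deleteIncidenceSet w`: `d(v) − 1` if `v ∼ w`, `d(v)` otherwise. -/
theorem deg_deleteIncidenceSet (H : SimpleGraph V) [DecidableRel H.Adj] (w v : V) (hv : v ≠ w) :
    deg (H.deleteIncidenceSet w) v = if H.Adj v w then deg H v - 1 else deg H v := by
  unfold deg
  rw [nbhd_deleteIncidenceSet H w v hv, card_erase_eq_ite]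
  by_cases h : H.Adj v w
  · have hmem : w ∈ univ.filter (fun u => H.Adj v u) := by rw [mem_filter]; exact ⟨mem_univ _, h⟩
    rw [if_pos hmem, if_pos h]
  · have hmem : w ∉ univ.filter (fun u => H.Adj v u) := by rw [mem_filter]; exact fun h' => h h'.2
    rw [if_neg hmem, if_neg h]

/-- `w` is isolated in `H.deleteIncidenceSet w`. -/
theorem deg_deleteIncidenceSet_self (H : SimpleGraph V) [DecidableRel H.Adj] (w : V) :
    deg (H.deleteIncidenceSet w) w = 0 := by
  unfold deg
  rw [card_eq_zero, filter_eq_empty_iff]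
  intro u _ h
  rw [SimpleGraph.deleteIncidenceSet_adj] at h
  exact h.2.1 rfl

/-- **THE SQUARE SUM UNDER THE DELETION OF THE EDGES AT `w`:**
`Σ_v d(v)² = Σ_v d′(v)² + x² + x + 2 Σ_{u ∼ w} (d(u) − 1)`, `x = d(w)`. -/
theorem sum_deg_sq_deleteIncidenceSet (H : SimpleGraph V) [DecidableRel H.Adj] (w : V) :
    ∑ v, deg H v * deg H v =
      ∑ v, deg (H.deleteIncidenceSet w) v * deg (H.deleteIncidenceSet w) v + deg H w * deg H w + deg H w +
        2 * ∑ u ∈ univ.filter (fun u => H.Adj w u), (deg H u - 1) := by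
  have hpt : ∀ v, deg H v * deg H v = deg (H.deleteIncidenceSet w) v * deg (H.deleteIncidenceSet w) v +
      (if v = w then deg H w * deg H w else if H.Adj w v then 2 * (deg H v - 1) + 1 else 0) := by
    intro v
    by_cases hv : v = w
    · subst hv
      rw [deg_deleteIncidenceSet_self, if_pos rfl]
      ring
    · rw [if_neg hv, deg_deleteIncidenceSet H w v hv]
      by_cases h : H.Adj v w
      · have h' : H.Adj w v := H.adj_symm h
        rw [if_pos h, if_pos h']
        have h1 : 1 ≤ deg H v := by
          unfold deg
          apply card_pos.mpr
          exact ⟨w, by rw [mem_filter]; exact ⟨mem_univ _, h⟩⟩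
        obtain ⟨d, hd⟩ : ∃ d, deg H v = d + 1 := ⟨deg H v - 1, by omega⟩
        rw [hd, Nat.add_sub_cancel]
        ring
      · have h' : ¬ H.Adj w v := fun h' => h (H.adj_symm h')
        rw [if_neg h, if_neg h', add_zero]
  rw [sum_congr rfl (fun v _ => hpt v), sum_add_distrib]
  have hsplit : ∑ v, (if v = w then deg H w * deg H w else if H.Adj w v then 2 * (deg H v - 1) + 1 else 0) =
      deg H w * deg H w + ∑ v ∈ univ.filter (fun u => H.Adj w u), (2 * (deg H v - 1) + 1) := by
    rw [← sum_erase_add (s := univ) (a := w) _ (mem_univ w), if_pos rfl]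
    rw [add_comm]
    congr 1
    rw [sum_filter]
    rw [← sum_erase_add (s := univ) (a := w) _ (mem_univ w)]
    have hw : ¬ H.Adj w w := H.irrefl
    rw [if_neg hw, add_zero]
    apply sum_congr rfl
    intro v hv
    rw [mem_erase] at hv
    rw [if_neg hv.1]
  rw [hsplit, sum_add_distrib, sum_const, card_filter, ← mul_sum]
  have hdeg : deg H w = ∑ v, if H.Adj w v then 1 else 0 := deg_eq_sum_boole H w
  rw [smul_eq_mul, mul_one, ← hdeg]
  ring

/-- **THE VERTEX BOUND WITH THE LEAF TERM EXPLICIT:** a triangle-free graph with `s` edges and a vertex `w` of degree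
`x` has `Σ_v d(v)² + 2x (s − x) ≤ s (s + 1) + 2 Σ_{u ∼ w} (d(u) − 1)`. -/
theorem sum_deg_sq_le_of_vertex_leaf (H : SimpleGraph V) [DecidableRel H.Adj] (hfree : H.CliqueFree 3) (w : V) :
    ∑ v, deg H v * deg H v + 2 * (deg H w * (H.edgeFinset.card - deg H w)) ≤
      H.edgeFinset.card * (H.edgeFinset.card + 1) + 2 * ∑ u ∈ univ.filter (fun u => H.Adj w u), (deg H u - 1) := by
  have hfree' : (H.deleteIncidenceSet w).CliqueFree 3 := hfree.anti (H.deleteIncidenceSet_le w)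
  have hvb := sum_deg_sq_le_of_vertex (H.deleteIncidenceSet w) hfree' w
  rw [deg_deleteIncidenceSet_self] at hvb
  simp only [Nat.zero_sub, mul_zero, add_zero] at hvb
  have hcard : (H.deleteIncidenceSet w).edgeFinset.card = H.edgeFinset.card - deg H w := by
    rw [SimpleGraph.card_edgeFinset_deleteIncidenceSet, deg_eq_degree]
  rw [hcard] at hvb
  have hx : deg H w ≤ H.edgeFinset.card := by
    rw [deg_eq_degree, ← H.card_incidenceFinset_eq_degree]
    exact card_le_card (H.incidenceFinset_subset w)
  have hsum := sum_deg_sq_deleteIncidenceSet H w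
  rw [hsum]
  obtain ⟨s', hs'⟩ : ∃ s', H.edgeFinset.card = deg H w + s' := ⟨H.edgeFinset.card - deg H w, by omega⟩
  rw [hs', Nat.add_sub_cancel_left] at hvb ⊢
  nlinarith [hvb]

/-- **THE VERTEX BOUND WITH THE LEAF TERM ON THE BIPARTITE CLASS:** a spanning subgraph of `K(A, Aᶜ)`, `|A| = a`, with
`s` missing cross pairs (`s + 1 ≤ k`), `x` of them at the vertex `w`, has
`Σ_v d(v)² + s (k − 1 − s) + 2x (s − x) ≤ m k + 2 Σ_{u missing at w} (h(u) − 1)`, `h` the missing degrees. -/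
theorem closed_form_stability_bipSub_leaf (D : SimpleGraph V) [DecidableRel D.Adj] (A : Finset V)
    (hD : BipSub D A) (a s : ℕ) (hA : A.card = a) (hm : D.edgeFinset.card + s = a * (Fintype.card V - a))
    (hs1 : s + 1 ≤ Fintype.card V) (w : V) :
    ∑ v, deg D v * deg D v + s * (Fintype.card V - 1 - s) +
        2 * (deg (missingGraph D A) w * (s - deg (missingGraph D A) w)) ≤
      D.edgeFinset.card * Fintype.card V +
        2 * ∑ u ∈ univ.filter (fun u => (missingGraph D A).Adj w u), (deg (missingGraph D A) u - 1) := by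
  have key := sum_deg_sq_bipSub D A hD
  have hM := card_edges_missingGraph D A hD a s hA hm
  rw [hM, hA] at key
  have hfree := cliqueFree_of_bipSub (missingGraph D A) A (bipSub_missingGraph D A)
  have hstab := sum_deg_sq_le_of_vertex_leaf (missingGraph D A) hfree w
  rw [hM] at hstab
  obtain ⟨t, ht⟩ : ∃ t, Fintype.card V = s + 1 + t := ⟨_, (Nat.add_sub_cancel' hs1).symm⟩
  have e : s + 1 + t - 1 - s = t := by omega
  rw [ht, e]
  rw [ht] at key hm
  generalize hS : ∑ v, deg D v * deg D v = S at key
  generalize hH : ∑ v, deg (missingGraph D A) v * deg (missingGraph D A) v = H at key hstab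
  generalize hM' : D.edgeFinset.card = M at key hm
  generalize hP : a * (s + 1 + t - a) = P at key hm
  generalize hx : deg (missingGraph D A) w * (s - deg (missingGraph D A) w) = X at hstab ⊢
  generalize hL : ∑ u ∈ univ.filter (fun u => (missingGraph D A).Adj w u), (deg (missingGraph D A) u - 1) = L
    at hstab ⊢
  nlinarith [key, hm, hstab]

end C047

end TriangleCap

end PercRepro
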